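import Mathlib.Algebra.Order.Field.GeomSum
import Mathlib.Analysis.SpecialFunctions.Pow.Real
import HarnessLib

/-!
# (n3)-COMB (II), row `hMcomb₂`, located difficulty H2-1 — THE `d = 3` DOUBLE GEOMETRIC SUMS OF THE `ℓ¹` KNIT (real numbers; `l` enters only through `Lˡ`)

Crux `stmt-QuantumFields-19200` `MinimiserStabilityRegPr`, route-R E′ (A′)-on-Σ, P-A2 (β); companion of `…CornerCombFlatL1Localised` (the flat `ℓ¹` knit with corner-localised
reading).  Width seat `ym3-torus-px18` (gen 4); `--kind proof --supports stmt-QuantumFields-19200 --as helper`; THEOREMS ONLY; «(O2) groundwork»; count-neutral.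
YM₃ on T³ is a ladder rung (R3), not Clay; nothing here is progress on the YM mass gap.

THE POINT (px18 g4 LOCATE `LOCATE-H2-1-KNIT-px18g4.md` ba06020f §2 (f)): in the H2-1 knit the pair (j, i) of source level `j` and sampling level `i` (`j < i < l`) contributes
`L^{−2(i−j−1)}·[c·L^{3(i+1−l)}·(Am·L^{−j} + Bm·Lʲ) + c′·L^{2(i−j+1)}·Γ_j]`; summed, the A-slot is `∝ L^{5−3l}·Σ_{j<i<l}L^{i+j} ≤ c(L)·Am·L^{−l}` — THE DECAY SURVIVES —, the
B-slot (mass) `∝ L^{5−3l}·Σ L^{i+3j} ≤ c(L)·Bm·Lˡ`, and the gradient part `∝ Σ_{j<l}(l−1−j)·Lʲ·(KD-class) ≤ c(L)·Lˡ` with NO factor `l`.  These three sums, as stated, nothing else.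
* `sum_range_pow_le` (`Σ_{j<l}Lʲ ≤ Lˡ∕(L−1)`), ★ `sum_range_sub_mul_pow_le` (`Σ_{j<l}(l−1−j)Lʲ ≤ Lˡ∕(L−1)²`), ★ `sum_sum_pow_add_le` (`Σ_{i<l}Σ_{j<i}L^{i+j} ≤ L^{2l}∕((L²−1)(L−1))`),
  ★ `sum_sum_pow_add_three_mul_le` (`Σ_{i<l}Σ_{j<i}L^{i+3j} ≤ L^{4l}∕((L⁴−1)(L³−1))`).
HONEST: elementary real inequalities (induction on `l` + the geometric sum); nothing of H2-1 ∕ `hMcomb₂` ∕ the crux is proved or claimed; rung R3, NOT d = 4, NOT Clay; YM gap NOT proved.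
References: T. Bałaban, CMP 98 (1985) 17–51 [Balaban1985Averaging] ((43) p.24, (125) p.36 — the straight∕cornered averaging towers whose `ℓ¹` weights these sums add up).
-/

set_option autoImplicit false

open scoped BigOperators
open Finset

namespace Summit.QuantumFields.YangMills.Theorems.Prop7CornerCombH21DoubleSums

/-- `Σ_{j<l} Lʲ ≤ Lˡ∕(L−1)` for `1 < L`. [folklore] -/
theorem sum_range_pow_le {L : ℝ} (hL : 1 < L) (l : ℕ) : ∑ j ∈ Finset.range l, L ^ j ≤ L ^ l / (L - 1) := by
  have hL1 : L - 1 ≠ 0 := by linarith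
  have hLpos : 0 < L - 1 := by linarith
  rw [geom_sum_eq (by linarith : L ≠ 1), div_le_div_iff_of_pos_right hLpos]
  linarith [pow_pos (by linarith : (0:ℝ) < L) l]

/-- ★ `Σ_{j<l} (l−1−j)·Lʲ ≤ Lˡ∕(L−1)²` (`1 < L`) — the level count summed against a geometric weight carries NO factor `l`. [folklore] -/
theorem sum_range_sub_mul_pow_le {L : ℝ} (hL : 1 < L) (l : ℕ) :
    ∑ j ∈ Finset.range l, ((l : ℝ) - 1 - j) * L ^ j ≤ L ^ l / (L - 1) ^ 2 := by
  have hLpos : 0 < L - 1 := by linarith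
  have hL0 : 0 < L := by linarith
  induction l with
  | zero => simp; positivity
  | succ l ih =>
    have hsplit : ∑ j ∈ Finset.range (l + 1), (((l + 1 : ℕ) : ℝ) - 1 - j) * L ^ j
        = ∑ j ∈ Finset.range l, ((l : ℝ) - 1 - j) * L ^ j + ∑ j ∈ Finset.range l, L ^ j := by
      rw [Finset.sum_range_succ, ← Finset.sum_add_distrib]
      have : (((l + 1 : ℕ) : ℝ) - 1 - (l : ℕ)) * L ^ l = 0 := by push_cast; ring
      rw [this, add_zero]
      refine Finset.sum_congr rfl fun j _ => ?_
      push_cast; ring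
    rw [hsplit]
    have h2 := sum_range_pow_le hL l
    calc ∑ j ∈ Finset.range l, ((l : ℝ) - 1 - j) * L ^ j + ∑ j ∈ Finset.range l, L ^ j
        ≤ L ^ l / (L - 1) ^ 2 + L ^ l / (L - 1) := add_le_add ih h2
      _ = L ^ (l + 1) / (L - 1) ^ 2 := by field_simp; ring

/-- ★ `Σ_{i<l}Σ_{j<i} L^{i+j} ≤ L^{2l}∕((L²−1)(L−1))` (`1 < L`) — the A-slot double sum of the Λ-sector (volume fraction × column decay). [folklore] -/
theorem sum_sum_pow_add_le {L : ℝ} (hL : 1 < L) (l : ℕ) :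
    ∑ i ∈ Finset.range l, ∑ j ∈ Finset.range i, L ^ (i + j) ≤ L ^ (2 * l) / ((L ^ 2 - 1) * (L - 1)) := by
  have hLpos : 0 < L - 1 := by linarith
  have hL2 : 0 < L ^ 2 - 1 := by nlinarith
  have hL0 : 0 < L := by linarith
  induction l with
  | zero => simp; positivity
  | succ l ih =>
    rw [Finset.sum_range_succ]
    have hin : ∑ j ∈ Finset.range l, L ^ (l + j) ≤ L ^ (2 * l) / (L - 1) := by
      have h := sum_range_pow_le hL l
      calc ∑ j ∈ Finset.range l, L ^ (l + j) = L ^ l * ∑ j ∈ Finset.range l, L ^ j := by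
            rw [Finset.mul_sum]; exact Finset.sum_congr rfl fun j _ => by rw [pow_add]
        _ ≤ L ^ l * (L ^ l / (L - 1)) := mul_le_mul_of_nonneg_left h (by positivity)
        _ = L ^ (2 * l) / (L - 1) := by rw [two_mul, pow_add]; ring
    calc ∑ i ∈ Finset.range l, ∑ j ∈ Finset.range i, L ^ (i + j) + ∑ j ∈ Finset.range l, L ^ (l + j)
        ≤ L ^ (2 * l) / ((L ^ 2 - 1) * (L - 1)) + L ^ (2 * l) / (L - 1) := add_le_add ih hin
      _ = L ^ (2 * (l + 1)) / ((L ^ 2 - 1) * (L - 1)) := by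
          rw [show 2 * (l + 1) = 2 * l + 2 by ring, pow_add]
          field_simp
          ring

/-- ★ `Σ_{i<l}Σ_{j<i} L^{i+3j} ≤ L^{4l}∕((L⁴−1)(L³−1))` (`1 < L`) — the B-slot (mass) double sum of the Λ-sector. [folklore] -/
theorem sum_sum_pow_add_three_mul_le {L : ℝ} (hL : 1 < L) (l : ℕ) :
    ∑ i ∈ Finset.range l, ∑ j ∈ Finset.range i, L ^ (i + 3 * j) ≤ L ^ (4 * l) / ((L ^ 4 - 1) * (L ^ 3 - 1)) := by
  have hL0 : 0 < L := by linarith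
  have hL3 : 0 < L ^ 3 - 1 := by nlinarith [pow_lt_pow_left₀ hL zero_le_one (by norm_num : (3:ℕ) ≠ 0)]
  have hL4 : 0 < L ^ 4 - 1 := by nlinarith [pow_lt_pow_left₀ hL zero_le_one (by norm_num : (4:ℕ) ≠ 0)]
  have hL3ne : L ^ 3 ≠ 1 := by linarith
  induction l with
  | zero => simp; positivity
  | succ l ih =>
    rw [Finset.sum_range_succ]
    have hin : ∑ j ∈ Finset.range l, L ^ (l + 3 * j) ≤ L ^ (4 * l) / (L ^ 3 - 1) := by
      have hg : ∑ j ∈ Finset.range l, (L ^ 3) ^ j ≤ (L ^ 3) ^ l / (L ^ 3 - 1) := by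
        rw [geom_sum_eq hL3ne, div_le_div_iff_of_pos_right hL3]
        linarith [pow_pos (pow_pos hL0 3) l]
      calc ∑ j ∈ Finset.range l, L ^ (l + 3 * j) = L ^ l * ∑ j ∈ Finset.range l, (L ^ 3) ^ j := by
            rw [Finset.mul_sum]; exact Finset.sum_congr rfl fun j _ => by rw [pow_add, pow_mul]
        _ ≤ L ^ l * ((L ^ 3) ^ l / (L ^ 3 - 1)) := mul_le_mul_of_nonneg_left hg (by positivity)
        _ = L ^ (4 * l) / (L ^ 3 - 1) := by
            rw [← pow_mul, show 4 * l = l + 3 * l by ring, pow_add]; ring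
    calc ∑ i ∈ Finset.range l, ∑ j ∈ Finset.range i, L ^ (i + 3 * j) + ∑ j ∈ Finset.range l, L ^ (l + 3 * j)
        ≤ L ^ (4 * l) / ((L ^ 4 - 1) * (L ^ 3 - 1)) + L ^ (4 * l) / (L ^ 3 - 1) := add_le_add ih hin
      _ = L ^ (4 * (l + 1)) / ((L ^ 4 - 1) * (L ^ 3 - 1)) := by
          rw [show 4 * (l + 1) = 4 * l + 4 by ring, pow_add]
          field_simp
          ring

end Summit.QuantumFields.YangMills.Theorems.Prop7CornerCombH21DoubleSums
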